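import Literature.Analysis.FluidPDE.TaoLocalisation
import HarnessLib

/-!
# Tao (2011/2013), Thm. 5.4 (ii) + (iv): local existence of smooth solutions with explicit
# lifespan, for smooth `H^∞` data (family `ns`, topic `Literature/Analysis/FluidPDE`)

Named fact (D-0014: `def … : Prop`, no `sorry`) from

* T. Tao, *Localisation and compactness properties of the Navier–Stokes global regularity
  problem*, Anal. PDE 6 (2013), 25–107 = arXiv:1108.1165 (`Tao2011`), §5, Thm. 5.4
  (arXiv Thm. 31, p. 18), items (i), (ii), (iv) and the note closing the proof of (iv).

It is the local-existence input of the third assembly of the `L³` continuation criterion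
`NS.hasSmoothExtensionPast_of_eLpNorm_three_bounded` (`NSCriticalClosure.lean`; assemblies in
`NSCriticalClosureProofs.lean`), where it replaces Leray's 1934 `L^∞` theory
(`NS.leray_blowup_rate_top`): together with the enstrophy inequality under an `L^∞` bound it
yields a uniform lifespan near the putative blow-up time.

## The printed statement (Tao2011, Thm. 5.4 = arXiv Thm. 31, p. 18; `ν = 1`)

"Let `(u₀, f, T)` be `H¹` data. (i) (Strong solution) If `(u, p, u₀, f, T, 1)` is an `H¹` mild
solution, then `u ∈ C⁰_t H¹_x([0, T] × ℝ³)`. (ii) (Local existence and regularity) If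
`(‖u₀‖_{H¹_x(ℝ³)} + ‖f‖_{L¹_t H¹_x(ℝ³)})⁴ T ≤ c` for a sufficiently small absolute constant
`c > 0`, then there exists a `H¹` mild solution `(u, p, u₀, f, T)` with the indicated data, with
`‖u‖_{X¹([0,T] × ℝ³)} ≲ ‖u₀‖_{H¹_x} + ‖f‖_{L¹_t H¹_x}` and more generally
`‖u‖_{X^k([0,T] × ℝ³)} ≲_{k, ‖u₀‖_{H^k_x}, ‖f‖_{L¹_t H^k_x}, 1}` for each `k ≥ 1`. […]
(iv) (Regularity) If `(u, p, u₀, f, T, 1)` is a `H¹` mild solution, and `(u₀, f, T)` is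
Schwartz, then `u` and `p` are smooth; in fact, one has
`∂ₜʲ u, ∂ₜʲ p ∈ L^∞_t H^k([0, T] × ℝ³)` for all `j, k ≥ 0`." Note closing the proof of (iv):
"these arguments did not require the full power of the hypothesis that `(u₀, f, T)` was
Schwartz; it would have sufficed to have `u₀ ∈ H^k_x(ℝ³)` and `f ∈ C^j_t H^k_x(ℝ³)` for all
`j, k ≥ 0`."

Here (Tao2011, §1, Def. 1.1 and p. 6; §2 p. 8): *`H¹` data* `(u₀, 0, T)` means
`u₀ ∈ H¹_x(ℝ³)` divergence free; an *`H¹` mild solution* has `u ∈ L^∞_t H¹_x ∩ L²_t H²_x`, the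
normalised pressure `p = -Δ⁻¹∂ᵢ∂ⱼ(uᵢuⱼ)` and obeys Duhamel's formula, so that when `u`, `p`
are smooth on `[0, T] × ℝ³` the quintuple `(u, p, u₀, 0, T)` is a *smooth solution* (NS (3),
(4), (5) on all of `[0, T] × ℝ³`, p. 3); `‖u‖_{H^k_x} = (∑_{j ≤ k} ‖∇ʲu‖²_{L²})^{1/2}` with the
Euclidean tensor norms (p. 8, "equivalent up to constants" to the Fourier definition).

## Rendering

* Homogeneous case `f = 0`; viscosity `ν > 0` by the rescaling of Tao's footnote 3
  (`v(s, x) = ν⁻¹ u(s/ν, x)`, `q = ν⁻² p(s/ν, x)` solve the `ν = 1` system on `[0, νT]` iff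
  `(u, p)` solve the `ν` system on `[0, T]`; `‖v(0)‖_{H¹} = ν⁻¹‖u₀‖_{H¹}`), under which the
  smallness hypothesis of (ii) reads `‖u₀‖⁴_{H¹} T ≤ c ν³`.
* Datum: `u₀` smooth, divergence free, with `∫ ‖Dⁿu₀‖² < ∞` for every `n` (the closing note;
  Schwartz data qualify, `HasRapidSpatialDecay.lintegral_enorm_iteratedFDeriv_sq_lt_top`). The
  `H¹` norm entering the smallness condition is `‖u₀‖²_{L²} + ‖∇u₀‖²_{L²}` with the Frobenius
  (Euclidean) norm of `∇u₀` (`Fluid.frobeniusNormSq`), Tao's classical convention; any other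
  equivalent choice only changes the unspecified absolute constant `c`.
* Conclusion: a classical solution `(u, p)` on the **closed** slab `[0, T] × ℝ³`
  (`Fluid.IsClassicalNSSolutionOn (Icc 0 T)`: jointly `C^∞` up to `t = 0` and `t = T`, which is
  Tao's "smooth on `[0, T] × ℝ³`") with `u 0 = u₀`, and the `L^∞_t H^k_x` bounds of (iv) for
  `u` (`j = 0`: `NS.HasBoundedSobolevNormsOn (Icc 0 T) u`), for `∂ₜu` (`j = 1`, the one-sided
  time derivative `Fluid.timeDerivWithin (Icc 0 T) u` of the accepted classical-solution
  predicate) and for `p` (`j = 0`), plus the strong continuity `u ∈ C([0, T]; L²)` contained in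
  (i) (`C⁰_t H¹_x ⊂ C⁰_t L²_x`; accepted `Fluid.ContinuousInLpOn`). The quantitative `X^k`
  bounds of (ii), uniqueness (iii) and stability (v) are not vendored here.

Nothing is asserted; users take `(h : tao2011_smooth_local_existence)`.

## Mathlib / tree search

Mathlib has no Navier–Stokes theory. Tree (`lean search`): the nearest facts are
`Fluid.local_classical_lerayHopf` (`NSLocalClassical.lean`: `∃ T > 0` for Schwartz data, no
lifespan bound, no Sobolev bounds), `NS.kato_local` / `NS.fujita_kato_local`
(`MildSolutions.lean`: critical-space mild solutions, no smoothness), and the Tao facts of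
`TaoLocalisation.lean` / `TaoH1Mild.lean` (Cor. 11.1, Cor. 4.3, Thm. 5.4 (iv) *for solutions
already known to be classical on the closed slab*); none gives existence with a lifespan
controlled by `‖u₀‖_{H¹}`, which is the content needed for continuation arguments.

## References

* T. Tao, arXiv:1108.1165 = Anal. PDE 6 (2013): Def. 1.1 and (3)–(7) (pp. 2–3), `H¹` mild
  solutions (p. 6), Sobolev norms (p. 8), footnote 3 (p. 4), Thm. 5.4 = arXiv Thm. 31 (p. 18)
  with the note closing its proof. Page numbers refer to the held arXiv text.
-/

noncomputable section

open MeasureTheory Set Function Filter Topology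
open scoped ENNReal NNReal ContDiff

namespace Literature.Analysis.FluidPDE

/-- **Tao 2011, Thm. 5.4 (ii) + (iv) (with (i) and the note closing the proof of (iv)):
local existence of smooth solutions with lifespan controlled by the `H¹` norm of the datum.**
There is an absolute constant `c > 0` such that: for `ν > 0`, `T > 0` and a smooth,
divergence-free datum `u₀ : ℝ³ → ℝ³` with `∫ ‖Dⁿu₀‖² < ∞` for every `n` (in particular for
Schwartz data), if `(‖u₀‖²_{L²} + ‖∇u₀‖²_{L²})² · T ≤ c ν³` (i.e. `‖u₀‖⁴_{H¹} T ≤ c ν³`, Tao's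
(ii) with `f = 0` after the footnote-3 rescaling to viscosity `ν`; written with a real number
`A ≥ ‖u₀‖²_{H¹}`, `A ≥ 0`), then there is a classical solution `(u, p)` of the unforced Navier–Stokes
system on the closed slab `[0, T] × ℝ³` with `u(0) = u₀` (Tao's `H¹` mild solution of (ii), smooth
on `[0, T] × ℝ³` by (iv) since `u₀ ∈ H^k_x` for all `k`, `p` the normalised pressure), such that
`u, ∂ₜu, p ∈ L^∞_t H^k_x([0, T] × ℝ³)` for every `k` ((iv): `∂ₜʲu, ∂ₜʲp ∈ L^∞_t H^k` for all
`j, k`; here `j ≤ 1` for `u`, `j = 0` for `p`) and `u ∈ C([0, T]; L²)` ((i): `u ∈ C⁰_t H¹_x`).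
[cite: Tao2011, Thm. 5.4 (ii)+(iv)] -/
def tao2011_smooth_local_existence : Prop :=
  ∃ c : ℝ, 0 < c ∧ ∀ ⦃ν T : ℝ⦄, 0 < ν → 0 < T →
    ∀ ⦃u₀ : EuclideanSpace ℝ (Fin 3) → EuclideanSpace ℝ (Fin 3)⦄,
      ContDiff ℝ ∞ u₀ → VectorCalculus.IsDivFree u₀ →
      (∀ n : ℕ, ∫⁻ x, ‖iteratedFDeriv ℝ n u₀ x‖ₑ ^ 2 < ⊤) →
      ∀ ⦃A : ℝ⦄, 0 ≤ A →
        (∫⁻ x, ‖u₀ x‖ₑ ^ 2) + (∫⁻ x, ENNReal.ofReal (FluidPDE.frobeniusNormSq (fderiv ℝ u₀ x))) ≤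
            ENNReal.ofReal A →
        A ^ 2 * T ≤ c * ν ^ 3 →
        ∃ (u : ℝ → EuclideanSpace ℝ (Fin 3) → EuclideanSpace ℝ (Fin 3))
          (p : ℝ → EuclideanSpace ℝ (Fin 3) → ℝ),
          FluidPDE.IsClassicalNSSolutionOn (Icc 0 T) ν 0 u p ∧ u 0 = u₀ ∧
          HasBoundedSobolevNormsOn (Icc 0 T) u ∧
          HasBoundedSobolevNormsOn (Icc 0 T) (FluidPDE.timeDerivWithin (Icc 0 T) u) ∧
          (∀ n : ℕ, ∃ C : ℝ≥0, ∀ t ∈ Icc 0 T, ∫⁻ x, ‖iteratedFDeriv ℝ n (p t) x‖ₑ ^ 2 ≤ C) ∧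
          FluidPDE.ContinuousInLpOn (Icc 0 T) 2 u

end Literature.Analysis.FluidPDE

end
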